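import Literature.Probability.RandomPlanarGeometry.RestrictionHulls
import Literature.Topology.PlaneTopology.HalfPlaneArc
import Literature.Analysis.Complex.SimplyConnectedOfCompl
import HarnessLib

/-!
# Slits are `+`-hulls

G. F. Lawler, O. Schramm, W. Werner, *Conformal restriction: the chordal case*, J. Amer. Math.
Soc. **16** (2003), proof of Lemma 3.5, p. 13, uses the hulls `β[0, t]` of the initial arcs of a
simple path `β : [0, s] → ℍ̄` with `β(0) ∈ (0, ∞)`, `β(0, t] ⊆ ℍ` ("`g_t := g_{β[0,t]}`,
`Φ_t := Φ_{β[0,t]}`"); G. F. Lawler, *Conformally Invariant Processes in the Plane* (2005), §4.1: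
"`H_t = ℍ ∖ γ[0, t]`, which is a simply connected subdomain of `ℍ`". This file PROVES that such a
slit is a `+`-hull of the tree (`IsPlusHull`, `RestrictionHulls`):

* `Literature.Probability.RandomPlanarGeometry.isPlusHull_slit` — for `γ` continuous and
  injective on `[0, u]` (`u > 0`) with `γ(0)` real and positive and `γ(0, u] ⊆ ℍ`, the set
  `γ[0, u]` is in `𝒬₊`: compact, the closure of its part `γ(0, u]` in `ℍ`, with `ℍ ∖ γ[0, u]`
  connected (a Jordan arc hanging from a real point does not separate `ℍ`,
  `Literature.Topology.PlaneTopology.isConnected_upperHalfPlaneSet_diff_arc`) and simply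
  connected (its complement `{Im ≤ 0} ∪ γ[0, u]` is connected and unbounded, Conway VIII.2.2,
  `Complex.isSimplyConnected_of_compl`), `0 ∉ γ[0, u]`, real points `> 0`.

## References

* [LSW] proof of Lemma 3.5, p. 13 [LawlerSchrammWerner2003Restriction].
* G. F. Lawler (2005), §4.1 [Lawler2005]; J. B. Conway (1978), Thm. VIII.2.2 [Conway1978].
-/

noncomputable section

open Set Filter Metric Complex Bornology
open UpperHalfPlane (upperHalfPlaneSet isOpen_upperHalfPlaneSet)
open scoped unitInterval

namespace Literature.Probability.RandomPlanarGeometry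

section Slit

variable {γ : ℝ → ℂ} {u : ℝ}

/-- The part of the slit in `ℍ` is `γ(0, u]`. [folklore] -/
theorem slit_inter_upperHalfPlaneSet (hu : 0 < u) (h0 : (γ 0).im = 0)
    (hpos : ∀ t ∈ Ioc 0 u, 0 < (γ t).im) :
    γ '' Icc 0 u ∩ upperHalfPlaneSet = γ '' Ioc 0 u := by
  have _ := hu
  ext z
  constructor
  · rintro ⟨⟨t, ht, rfl⟩, hzH⟩
    rcases ht.1.lt_or_eq with hlt | heq
    · exact ⟨t, ⟨hlt, ht.2⟩, rfl⟩
    · rw [← heq] at hzH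
      exact absurd h0 (ne_of_gt (show 0 < (γ 0).im from hzH))
  · rintro ⟨t, ht, rfl⟩
    exact ⟨⟨t, ⟨ht.1.le, ht.2⟩, rfl⟩, hpos t ht⟩

/-- `γ(0)` is in the closure of `γ(0, u]`. [folklore] -/
theorem apply_zero_mem_closure_slit (hu : 0 < u) (hγc : ContinuousOn γ (Icc 0 u)) :
    γ 0 ∈ closure (γ '' Ioc 0 u) := by
  have h0 : ContinuousWithinAt γ (Ioc 0 u) 0 := (hγc 0 ⟨le_rfl, hu.le⟩).mono Ioc_subset_Icc_self
  refine h0.mem_closure_image ?_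
  rw [closure_Ioc hu.ne]
  exact ⟨le_rfl, hu.le⟩

/-- **The slit is the closure of its part in `ℍ`.** [folklore] -/
theorem closure_slit_inter (hu : 0 < u) (hγc : ContinuousOn γ (Icc 0 u)) (h0 : (γ 0).im = 0)
    (hpos : ∀ t ∈ Ioc 0 u, 0 < (γ t).im) :
    closure (γ '' Icc 0 u ∩ upperHalfPlaneSet) = γ '' Icc 0 u := by
  rw [slit_inter_upperHalfPlaneSet hu h0 hpos]
  have hcl : IsClosed (γ '' Icc 0 u) := (isCompact_Icc.image_of_continuousOn hγc).isClosed
  refine Subset.antisymm (hcl.closure_subset_iff.2 (image_mono Ioc_subset_Icc_self)) ?_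
  rintro _ ⟨t, ht, rfl⟩
  rcases ht.1.lt_or_eq with hlt | heq
  · exact subset_closure ⟨t, ⟨hlt, ht.2⟩, rfl⟩
  · rw [← heq]; exact apply_zero_mem_closure_slit hu hγc

/-- **A homeomorphism `[0, 1] ≅ γ[0, u]`** (`s ↦ γ(us)`; continuous bijection from a compact
space to a Hausdorff space). [folklore] -/
theorem exists_homeomorph_slit (hu : 0 < u) (hγc : ContinuousOn γ (Icc 0 u)) (hγi : InjOn γ (Icc 0 u)) :
    ∃ e : I ≃ₜ (γ '' Icc 0 u), ∀ s : I, ((e s : γ '' Icc 0 u) : ℂ) = γ (u * s) := by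
  have hmem : ∀ s : I, u * (s : ℝ) ∈ Icc 0 u := fun s ↦
    ⟨mul_nonneg hu.le s.2.1, mul_le_of_le_one_right hu.le s.2.2⟩
  set φ : I → γ '' Icc 0 u := fun s ↦ ⟨γ (u * s), mem_image_of_mem _ (hmem s)⟩ with hφ
  have hφc : Continuous φ := by
    refine Continuous.subtype_mk ?_ _
    exact hγc.comp_continuous (continuous_const.mul continuous_subtype_val) hmem
  have hφi : Function.Injective φ := by
    intro s s' h
    have h1 : γ (u * s) = γ (u * s') := congrArg (fun p : γ '' Icc 0 u ↦ (p : ℂ)) h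
    have h2 := hγi (hmem s) (hmem s') h1
    exact Subtype.ext (mul_left_cancel₀ hu.ne' h2)
  have hφs : Function.Surjective φ := by
    rintro ⟨_, t, ht, rfl⟩
    refine ⟨⟨t / u, div_nonneg ht.1 hu.le, div_le_one_of_le₀ ht.2 hu.le⟩, Subtype.ext ?_⟩
    simp [hφ, mul_div_cancel₀ t hu.ne']
  exact ⟨Continuous.homeoOfEquivCompactToT2 (f := Equiv.ofBijective φ ⟨hφi, hφs⟩) hφc, fun s ↦ rfl⟩

/-- **`ℍ` minus the slit is connected** (a Jordan arc hanging from a real point does not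
separate the half-plane). [folklore] -/
theorem isConnected_upperHalfPlaneSet_diff_slit (hu : 0 < u) (hγc : ContinuousOn γ (Icc 0 u))
    (hγi : InjOn γ (Icc 0 u)) (h0 : (γ 0).im = 0) (hpos : ∀ t ∈ Ioc 0 u, 0 < (γ t).im) :
    IsConnected (upperHalfPlaneSet \ γ '' Icc 0 u) := by
  obtain ⟨e, he⟩ := exists_homeomorph_slit hu hγc hγi
  refine Literature.Topology.PlaneTopology.isConnected_upperHalfPlaneSet_diff_arc e ?_ fun s hs ↦ ?_
  · rw [he]; simpa using h0
  · rw [he]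
    have hs' : 0 < (s : ℝ) := lt_of_le_of_ne s.2.1 (fun h ↦ hs (Subtype.ext h.symm))
    exact hpos _ ⟨mul_pos hu hs', mul_le_of_le_one_right hu.le s.2.2⟩

/-- **Slits are `+`-hulls**: for `γ` continuous and injective on `[0, u]`, `u > 0`, with
`γ(0) ∈ (0, ∞)` and `γ(0, u] ⊆ ℍ`, the slit `γ[0, u]` belongs to `𝒬₊` ([LSW] p. 13: the hulls
`β[0, t]`; Lawler (2005) §4.1: "`ℍ ∖ γ[0, t]` is a simply connected subdomain of `ℍ`").
[cite: LawlerSchrammWerner2003Restriction, proof of Lemma 3.5 (p. 13), the hulls β[0,t]] -/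
theorem isPlusHull_slit (hu : 0 < u) (hγc : ContinuousOn γ (Icc 0 u)) (hγi : InjOn γ (Icc 0 u))
    (h0 : (γ 0).im = 0) (h0re : 0 < (γ 0).re) (hpos : ∀ t ∈ Ioc 0 u, 0 < (γ t).im) :
    IsPlusHull (γ '' Icc 0 u) := by
  have hK : IsCompact (γ '' Icc 0 u) := isCompact_Icc.image_of_continuousOn hγc
  have hconn := isConnected_upperHalfPlaneSet_diff_slit hu hγc hγi h0 hpos
  have hopen : IsOpen (upperHalfPlaneSet \ γ '' Icc 0 u) := isOpen_upperHalfPlaneSet.sdiff hK.isClosed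
  -- the complement `{Im ≤ 0} ∪ γ[0, u]` is connected and unbounded
  have hL : IsConnected {z : ℂ | z.im ≤ 0} :=
    ((convex_halfSpace_im_le 0).isPathConnected ⟨-Complex.I, by simp⟩).isConnected
  have hT : IsConnected (γ '' Icc 0 u) :=
    ⟨⟨γ 0, mem_image_of_mem _ ⟨le_rfl, hu.le⟩⟩, isPreconnected_Icc.image _ hγc⟩
  have hcompl : (upperHalfPlaneSet \ γ '' Icc 0 u)ᶜ = {z : ℂ | z.im ≤ 0} ∪ γ '' Icc 0 u := by
    ext z
    simp only [mem_compl_iff, Set.mem_sdiff, not_and, not_not, mem_union, mem_setOf_eq]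
    constructor
    · intro h
      by_cases hz : 0 < z.im
      · exact Or.inr (h hz)
      · exact Or.inl (not_lt.1 hz)
    · rintro (h | h) hzH
      · exact absurd (show 0 < z.im from hzH) (not_lt.2 h)
      · exact h
  have hCc : IsConnected (upperHalfPlaneSet \ γ '' Icc 0 u)ᶜ := by
    rw [hcompl]
    exact IsConnected.union ⟨γ 0, show (γ 0).im ≤ 0 from h0.le, mem_image_of_mem _ ⟨le_rfl, hu.le⟩⟩ hL hT
  have hsc : IsSimplyConnected (upperHalfPlaneSet \ γ '' Icc 0 u) := by
    refine Complex.isSimplyConnected_of_compl hopen hconn fun a ha hb ↦ ?_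
    have hsub : (upperHalfPlaneSet \ γ '' Icc 0 u)ᶜ ⊆ connectedComponentIn (upperHalfPlaneSet \ γ '' Icc 0 u)ᶜ a :=
      hCc.isPreconnected.subset_connectedComponentIn ha subset_rfl
    have hray : ¬ IsBounded {z : ℂ | z.im ≤ 0} := by
      intro hbd
      obtain ⟨R, hR⟩ := hbd.subset_closedBall 0
      have hmem : -(((|R| + 1 : ℝ) : ℂ) * Complex.I) ∈ {z : ℂ | z.im ≤ 0} := by
        simp only [mem_setOf_eq, Complex.neg_im, Complex.mul_im, Complex.ofReal_re, Complex.I_im,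
          mul_one, Complex.ofReal_im, Complex.I_re, mul_zero, add_zero]
        linarith [abs_nonneg R]
      have := hR hmem
      rw [mem_closedBall_zero_iff, norm_neg, norm_mul, Complex.norm_I, mul_one, Complex.norm_real,
        Real.norm_of_nonneg (by positivity)] at this
      linarith [le_abs_self R]
    exact hray (hb.subset ((subset_union_left.trans hcompl.symm.subset).trans hsub))
  refine ⟨⟨⟨hK.isBounded, closure_slit_inter hu hγc h0 hpos, hsc⟩, ?_⟩, ?_⟩
  · -- `0 ∉ γ[0, u]`
    rintro ⟨t, ht, ht0⟩
    rcases ht.1.lt_or_eq with hlt | heq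
    · have := hpos t ⟨hlt, ht.2⟩
      rw [ht0] at this; simp at this
    · rw [← heq] at ht0
      have := congrArg Complex.re ht0
      simp at this; linarith
  · -- real points are positive
    rintro x ⟨t, ht, htx⟩
    rcases ht.1.lt_or_eq with hlt | heq
    · have := hpos t ⟨hlt, ht.2⟩
      rw [htx] at this; simp at this
    · rw [← heq] at htx
      have := congrArg Complex.re htx
      simp at this; linarith

end Slit

end Literature.Probability.RandomPlanarGeometry

end
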